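import Literature.Algebra.Homology.RepExtGroupCohomologyNaturality
import HarnessLib

/-!
# For a FINITE group, `Extⁿ_{Rep k G}(k, –)` commutes with directed unions (surjectivity and
# injectivity halves): finite groups are of type `FP_∞` via the bar resolution

Topic `Algebra/Homology`; namespace `Literature.Algebra.Homology.RepExt`.  Definitions with bodies (one
reindexing isomorphism of free representations) and theorems; no named fact, no instance, no `sorry`.
Sequel of `RepExtGroupCohomologyNaturality` (door-c4 g14: `Extⁿ_{Rep k G}(k, A) ≃+ Hⁿ(G, A)`
natural in `A`) and of the tree's `GroupCohomologyResolutionComparison` (`ResolutionComparison.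
exists_map_eq_of_directed / exists_map_eq_zero_of_directed`: `Hⁿ(G, lim→ A_i) = lim→ Hⁿ(G, A_i)` for
`G` of type `FP_∞`, i.e. admitting a projective resolution of `k` with terms `≅ k[G]^m`, Brown VIII
(4.6)).

* `freeCongrIso k G e : Rep.free k G α ≅ Rep.free k G β` for `e : α ≃ β` (`β : Type`, as in the
  tree's finite-type hypothesis `≅ Rep.free k G (Fin m)`);
  **`exists_barComplex_X_iso_free_fin`**: for `G` finite every term `k[G^{n}] = free k G (Fin n → G)`
  of Mathlib's bar resolution is `≅ free k G (Fin m)` — a finite group is of type `FP_∞`.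
* **`exists_comp_mk₀_eq_of_directed`**: `G` finite, `(φ_i : A_i ↪ B)` a directed family of
  subrepresentations exhausting `B`: every `x ∈ Extⁿ(k, B)` is `y ∘ φ_i` for some `i` and
  `y ∈ Extⁿ(k, A_i)`; **`exists_comp_mk₀_eq_zero_of_directed`**: a class `y ∈ Extⁿ(k, A_i)` with
  `y ∘ φ_i = 0` satisfies `y ∘ t_{ij} = 0` for some `j ≥ i`.

Written for Route A of the Poitou–Tate programme of crux `stmt-BirchSwinnertonDyer-19295` (cell
`bsd-schneider-ideate`, seat door-c4 gen 14), item (d): in the dimension-shifting proof of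
`Hʳ(Γ, M) = lim→_U Hʳ(Γ⧸U, M^U)` a class of the finite layer `Γ⧸U` with values in `Q^U` must be
moved into the part of `Q^U` that lifts to `I^V` for some deeper `V` (FINDING-door-c4-g14 §4).
HONEST FRAMING: homological algebra only.

## References
* K. S. Brown, *Cohomology of Groups*, GTM 87 (1982), VIII (4.5)–(4.8) (type `FP_∞`, `Ext*` and
  direct limits; finite groups). [Brown1982CohomologyGroups]
* J.-P. Serre, *Cohomologie des groupes discrets*, Ann. of Math. Studies 70 (1971), §1.8 Remarque.
  [Serre1971CohomologieGroupesDiscrets]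
-/

noncomputable section

universe u

namespace Literature.Algebra.Homology

namespace RepExt

open CategoryTheory CategoryTheory.Abelian

/-! ## §1 Finite groups are of type `FP_∞` -/

/-- **Reindexing a free representation along a bijection**: `free k G α ≅ free k G β` for `α ≃ β`
(on generators `single a 1 ↦ single (e a) 1`). [cite: Brown1982CohomologyGroups, VIII (4.5)] -/
def freeCongrIso (k G : Type u) [CommRing k] [Group G] {α : Type u} {β : Type} (e : α ≃ β) :
    Rep.free k G α ≅ Rep.free k G β where
  hom := Rep.freeLift k G (Rep.free k G β) fun a => Finsupp.single (e a) (MonoidAlgebra.single 1 1)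
  inv := Rep.freeLift k G (Rep.free k G α) fun b => Finsupp.single (e.symm b) (MonoidAlgebra.single 1 1)
  hom_inv_id := Rep.free_ext _ _ _ _ _ fun i => by
    simp [Representation.freeLift_single_single]
  inv_hom_id := Rep.free_ext _ _ _ _ _ fun i => by
    simp [Representation.freeLift_single_single]

variable {k G : Type u} [CommRing k] [Group G]

/-- **A finite group is of type `FP_∞`**: every term `free k G (Fin n → G)` of Mathlib's bar
resolution of the trivial representation is free of FINITE rank.
[cite: Brown1982CohomologyGroups, VIII (4.5)] -/
theorem exists_barComplex_X_iso_free_fin [Finite G] (n : ℕ) :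
    ∃ m : ℕ, Nonempty ((Rep.barResolution k G).complex.X n ≅ Rep.free k G (Fin m)) := by
  haveI : Finite (Fin n → G) := inferInstance
  exact ⟨Nat.card (Fin n → G), ⟨freeCongrIso k G (Finite.equivFinOfCardEq (α := Fin n → G) rfl)⟩⟩

/-! ## §2 `Extⁿ(k, –)` commutes with directed unions, `G` finite -/

section Union

variable [Finite G] {ι : Type*} [Preorder ι] [IsDirected ι (· ≤ ·)] [Nonempty ι]
  {A : ι → Rep.{u} k G} {B : Rep.{u} k G} (φ : ∀ i, A i ⟶ B)
  (hinj : ∀ i, Function.Injective (φ i).hom)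
  (t : ∀ ⦃i j⦄, i ≤ j → (A i ⟶ A j)) (ht : ∀ ⦃i j⦄ (h : i ≤ j), t h ≫ φ j = φ i)
  (hcov : ∀ b : B, ∃ i, ∃ a : A i, (φ i).hom a = b)

include hinj ht hcov in
/-- **Surjectivity half**: for `G` finite and a directed family of subrepresentations `A_i ↪ B`
exhausting `B`, every class of `Extⁿ_{Rep k G}(k, B)` comes from `Extⁿ(k, A_i)` for some `i`
(transport of `ResolutionComparison.exists_map_eq_of_directed` through
`extTrivialAddEquivGroupCohomology`). [cite: Brown1982CohomologyGroups, VIII (4.6)]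
[cite: Serre1971CohomologieGroupesDiscrets, §1.8 Remarque] -/
theorem exists_comp_mk₀_eq_of_directed (n : ℕ) (x : Ext (Rep.trivial k G k) B n) :
    ∃ i, ∃ y : Ext (Rep.trivial k G k) (A i) n, y.comp (Ext.mk₀ (φ i)) (add_zero n) = x := by
  obtain ⟨i, y', hy'⟩ := ResolutionComparison.exists_map_eq_of_directed (Rep.barResolution k G)
    exists_barComplex_X_iso_free_fin φ hinj t ht hcov n (extTrivialAddEquivGroupCohomology B n x)
  refine ⟨i, (extTrivialAddEquivGroupCohomology (A i) n).symm y', ?_⟩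
  apply (extTrivialAddEquivGroupCohomology B n).injective
  rw [extTrivialAddEquivGroupCohomology_naturality, AddEquiv.apply_symm_apply]
  exact hy'

include hinj ht hcov in
/-- **Injectivity half**: a class `y ∈ Extⁿ(k, A_i)` with `y ∘ φ_i = 0` already satisfies
`y ∘ t_{ij} = 0` for some `j ≥ i`. [cite: Brown1982CohomologyGroups, VIII (4.6)]
[cite: Serre1971CohomologieGroupesDiscrets, §1.8 Remarque] -/
theorem exists_comp_mk₀_eq_zero_of_directed (n : ℕ) (i : ι) (y : Ext (Rep.trivial k G k) (A i) n)
    (hy : y.comp (Ext.mk₀ (φ i)) (add_zero n) = 0) :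
    ∃ j, ∃ h : i ≤ j, y.comp (Ext.mk₀ (t h)) (add_zero n) = 0 := by
  have hy' : groupCohomology.map (MonoidHom.id G) (φ i) n
      (extTrivialAddEquivGroupCohomology (A i) n y) = 0 := by
    have h := extTrivialAddEquivGroupCohomology_naturality (φ i) n y
    rw [hy, map_zero] at h
    exact h.symm
  obtain ⟨j, hij, hj⟩ := ResolutionComparison.exists_map_eq_zero_of_directed (Rep.barResolution k G)
    exists_barComplex_X_iso_free_fin φ hinj t ht hcov n i _ hy'
  refine ⟨j, hij, ?_⟩
  apply (extTrivialAddEquivGroupCohomology (A j) n).injective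
  rw [extTrivialAddEquivGroupCohomology_naturality, map_zero]
  exact hj

end Union

end RepExt

end Literature.Algebra.Homology
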